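import Mathlib
import Summits.Ventures.PercRepro2.SwSide
import Summits.Ventures.PercRepro2.SwGlue

/-!
# Row (SW) across a cut at `o` (blind cell PercRepro2, night-4 g4, 2026-08-24; NIGHT4-SIDE.md §5′ P4)

When the cut vertex is `o` itself (`l` on one side, `h` on the other), `Q(G) = {o ∈ R_side(G₁)} ×
{h ↮_R o in G₂}` and an (SW) permutation of the glued graph is `(id, θ)` with `θ` a permutation of
`{o ∉ C_R(h)}` (on the `h`-side) carrying `C_R(h)` into `C_B(h)` of the image.  `θ` exists by Hall
from the counting inequality `#{o ∉ C_R(h), C_R(h) ∈ 𝓥} ≤ #{o ∉ C_R(h), C_B(h) ∈ 𝓥}` (every up-set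
`𝓥`), which is Harris on the full cube: the colour swap turns the left side into
`#{o ∉ C_B(h), C_B(h) ∈ 𝓥}` (an increasing and a decreasing event), the right side is two decreasing
events (`card_avoid_le`, `exists_avoidPerm`).  No hypothesis on the sides: `sw_glue_cut_o`.
-/

namespace Summit.Ventures.PercRepro2

namespace Glue

open Hull LocRows SwSide

open scoped Classical

variable {V : Type*}

section HarrisHall

variable {E : Type*} [Fintype E] [DecidableEq E] (ends : E → Sym2 V)

omit [Fintype E] [DecidableEq E] in
/-- Redder colourings have smaller blue colourings. -/
lemma blue_le_blue_of_le {ζ ζ' : Config E} (h : ζ ≤ ζ') : blue ζ' ≤ blue ζ := by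
  intro e
  have := h e
  simp only [blue_apply]
  revert this
  cases ζ e <;> cases ζ' e <;> simp

omit [Fintype E] [DecidableEq E] in
/-- `{o ∉ C_B(h)}` is increasing. -/
lemma isUpperSet_notMem_blue (o h : V) :
    IsUpperSet {ζ : Config E | o ∉ cluster ends (blue ζ) h} := by
  intro ζ ζ' hle hζ hζ'
  exact hζ (cluster_mono (blue_le_blue_of_le hle) h hζ')

omit [Fintype E] [DecidableEq E] in
/-- `{o ∉ C_R(h)}` is decreasing. -/
lemma isLowerSet_notMem_red (o h : V) :
    IsLowerSet {ζ : Config E | o ∉ cluster ends ζ h} := by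
  intro ζ ζ' hle hζ hζ'
  exact hζ (cluster_mono hle h hζ')

omit [Fintype E] [DecidableEq E] in
/-- `{C_B(h) ∈ 𝓥}` is decreasing for an up-set `𝓥`. -/
lemma isLowerSet_blueCluster_mem (h : V) {𝓥 : Set (Set V)} (h𝓥 : IsUpperSet 𝓥) :
    IsLowerSet {ζ : Config E | cluster ends (blue ζ) h ∈ 𝓥} := by
  intro ζ ζ' hle hζ
  exact h𝓥 (cluster_mono (blue_le_blue_of_le hle) h) hζ

/-- `cnt` over the full cube is the plain count. -/
lemma cnt_empty (ζ₀ : Config E) (A : Set (Config E)) :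
    cnt ζ₀ ∅ A = (Finset.univ.filter fun ζ => ζ ∈ A).card := by
  unfold cnt fib
  congr 1
  ext ζ
  simp only [Finset.mem_filter, Finset.mem_univ, true_and, Finset.notMem_empty, false_implies,
    implies_true]

/-- **Harris on a cylinder, counting form** (both events decreasing). -/
theorem cnt_mul_cnt_le_of_lower (ζ₀ : Config E) (F : Finset E) {X Y : Set (Config E)}
    (hX : IsLowerSet X) (hY : IsLowerSet Y) :
    cnt ζ₀ F X * cnt ζ₀ F Y ≤ cnt ζ₀ F (X ∩ Y) * 2 ^ Fᶜ.card := by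
  have h := prob_mul_prob_le_prob_inter_of_isLowerSet (isProbVec_pin ζ₀ F) hX hY
  rw [prob_pin, prob_pin, prob_pin] at h
  exact_mod_cast aux_le (half_pow_mul_two_pow Fᶜ.card) (by positivity) h

/-- The colour swap identifies `#{o ∉ C_R(h), C_R(h) ∈ 𝓥}` with `#{o ∉ C_B(h), C_B(h) ∈ 𝓥}`
(as an inequality, which is all we need). -/
lemma card_swap_le (o h : V) (𝓥 : Set (Set V)) :
    (Finset.univ.filter fun ζ : Config E => o ∉ cluster ends ζ h ∧ cluster ends ζ h ∈ 𝓥).card ≤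
      (Finset.univ.filter fun ζ : Config E =>
        o ∉ cluster ends (blue ζ) h ∧ cluster ends (blue ζ) h ∈ 𝓥).card := by
  refine Finset.card_le_card_of_injOn blue ?_ ?_
  · intro ζ hζ
    rw [Finset.mem_coe, Finset.mem_filter] at hζ
    rw [Finset.mem_coe, Finset.mem_filter, blue_blue]
    exact ⟨Finset.mem_univ _, hζ.2⟩
  · intro ζ₁ _ ζ₂ _ h12
    have := congrArg blue h12
    simpa only [blue_blue] using this

/-- The colour swap identifies `#{o ∉ C_B(h)}` with `#{o ∉ C_R(h)}`. -/
lemma card_notMem_blue_eq (o h : V) :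
    (Finset.univ.filter fun ζ : Config E => o ∉ cluster ends (blue ζ) h).card =
      (Finset.univ.filter fun ζ : Config E => o ∉ cluster ends ζ h).card := by
  refine Finset.card_bij (fun ζ _ => blue ζ) ?_ ?_ ?_
  · intro ζ hζ
    rw [Finset.mem_filter] at hζ ⊢
    exact ⟨Finset.mem_univ _, hζ.2⟩
  · intro ζ₁ _ ζ₂ _ h12
    have := congrArg blue h12
    simpa only [blue_blue] using this
  · intro ζ hζ
    rw [Finset.mem_filter] at hζ
    refine ⟨blue ζ, ?_, blue_blue ζ⟩
    rw [Finset.mem_filter, blue_blue]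
    exact ⟨Finset.mem_univ _, hζ.2⟩

/-- `cnt` over the full cube of a set given by a predicate. -/
lemma cnt_empty_pred (ζ₀ : Config E) (P : Config E → Prop) [DecidablePred P] :
    cnt ζ₀ ∅ {ζ | P ζ} = (Finset.univ.filter fun ζ => P ζ).card := by
  unfold cnt fib
  congr 1
  ext ζ
  simp only [Finset.mem_filter, Finset.mem_univ, true_and, Finset.notMem_empty, false_implies,
    implies_true, Set.mem_setOf_eq]

/-- `cnt` over the full cube of an intersection. -/
lemma cnt_empty_inter (ζ₀ : Config E) (P Q : Config E → Prop) [DecidablePred P] [DecidablePred Q] :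
    cnt ζ₀ ∅ ({ζ | P ζ} ∩ {ζ | Q ζ}) = (Finset.univ.filter fun ζ => P ζ ∧ Q ζ).card := by
  unfold cnt fib
  congr 1
  ext ζ
  simp only [Finset.mem_filter, Finset.mem_univ, true_and, Finset.notMem_empty, false_implies,
    implies_true, Set.mem_inter_iff, Set.mem_setOf_eq]

/-- **The avoidance domination** (Harris): for every up-set `𝓥`,
`#{o ∉ C_R(h), C_R(h) ∈ 𝓥} ≤ #{o ∉ C_R(h), C_B(h) ∈ 𝓥}`. -/
theorem card_avoid_le (o h : V) {𝓥 : Set (Set V)} (h𝓥 : IsUpperSet 𝓥) :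
    (Finset.univ.filter fun ζ : Config E => o ∉ cluster ends ζ h ∧ cluster ends ζ h ∈ 𝓥).card ≤
      (Finset.univ.filter fun ζ : Config E =>
        o ∉ cluster ends ζ h ∧ cluster ends (blue ζ) h ∈ 𝓥).card := by
  set ζ₀ : Config E := fun _ => false
  have hN : 0 < 2 ^ (∅ : Finset E)ᶜ.card := by positivity
  have h1 := cnt_le_cnt_mul_cnt_of_lower ζ₀ ∅ (X := {ζ : Config E | cluster ends (blue ζ) h ∈ 𝓥})
    (Y := {ζ : Config E | o ∉ cluster ends (blue ζ) h}) (isLowerSet_blueCluster_mem ends h h𝓥)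
    (isUpperSet_notMem_blue ends o h)
  have h2 := cnt_mul_cnt_le_of_lower ζ₀ ∅ (X := {ζ : Config E | o ∉ cluster ends ζ h})
    (Y := {ζ : Config E | cluster ends (blue ζ) h ∈ 𝓥}) (isLowerSet_notMem_red ends o h)
    (isLowerSet_blueCluster_mem ends h h𝓥)
  rw [cnt_empty_inter, cnt_empty_pred, cnt_empty_pred] at h1 h2
  have hswap := card_swap_le ends o h 𝓥
  have e1 : (Finset.univ.filter fun ζ : Config E =>
      o ∉ cluster ends (blue ζ) h ∧ cluster ends (blue ζ) h ∈ 𝓥).card =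
      (Finset.univ.filter fun ζ : Config E =>
      cluster ends (blue ζ) h ∈ 𝓥 ∧ o ∉ cluster ends (blue ζ) h).card := by
    congr 1; ext ζ; simp only [Finset.mem_filter]; tauto
  refine Nat.le_of_mul_le_mul_right ?_ hN
  calc (Finset.univ.filter fun ζ : Config E => o ∉ cluster ends ζ h ∧ cluster ends ζ h ∈ 𝓥).card *
        2 ^ (∅ : Finset E)ᶜ.card
      ≤ (Finset.univ.filter fun ζ : Config E =>
          cluster ends (blue ζ) h ∈ 𝓥 ∧ o ∉ cluster ends (blue ζ) h).card * 2 ^ (∅ : Finset E)ᶜ.card := by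
        rw [← e1]; exact Nat.mul_le_mul_right _ hswap
    _ ≤ (Finset.univ.filter fun ζ : Config E => cluster ends (blue ζ) h ∈ 𝓥).card *
          (Finset.univ.filter fun ζ : Config E => o ∉ cluster ends (blue ζ) h).card := h1
    _ = (Finset.univ.filter fun ζ : Config E => cluster ends (blue ζ) h ∈ 𝓥).card *
          (Finset.univ.filter fun ζ : Config E => o ∉ cluster ends ζ h).card := by
        rw [card_notMem_blue_eq ends o h]
    _ = (Finset.univ.filter fun ζ : Config E => o ∉ cluster ends ζ h).card *
          (Finset.univ.filter fun ζ : Config E => cluster ends (blue ζ) h ∈ 𝓥).card := by ring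
    _ ≤ (Finset.univ.filter fun ζ : Config E =>
          o ∉ cluster ends ζ h ∧ cluster ends (blue ζ) h ∈ 𝓥).card * 2 ^ (∅ : Finset E)ᶜ.card := h2

/-- The source / target set `{o ∉ C_R(h)}`. -/
noncomputable def avoidSet (o h : V) : Finset (Config E) :=
  Finset.univ.filter fun ζ => o ∉ cluster ends ζ h

/-- **The avoidance permutation** (Hall): an injection of `{o ∉ C_R(h)}` into itself carrying `C_R(h)`
into `C_B(h)` of the image. -/
theorem exists_avoidPerm (o h : V) :
    ∃ θ : {ζ // ζ ∈ avoidSet ends o h} → Config E, Function.Injective θ ∧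
      ∀ y, θ y ∈ avoidSet ends o h ∧ cluster ends y.1 h ⊆ cluster ends (blue (θ y)) h := by
  let t : {ζ // ζ ∈ avoidSet ends o h} → Finset (Config E) := fun y =>
    (avoidSet ends o h).filter fun ζ' => cluster ends y.1 h ⊆ cluster ends (blue ζ') h
  have hall : ∀ s : Finset {ζ // ζ ∈ avoidSet ends o h}, s.card ≤ (s.biUnion t).card := by
    intro s
    let 𝓥 : Set (Set V) := {S | ∃ y ∈ s, cluster ends y.1 h ⊆ S}
    have h𝓥 : IsUpperSet 𝓥 := by
      intro S S' hSS' ⟨y, hy, hyS⟩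
      exact ⟨y, hy, hyS.trans hSS'⟩
    have e1 : s.biUnion t = Finset.univ.filter fun ζ : Config E =>
        o ∉ cluster ends ζ h ∧ cluster ends (blue ζ) h ∈ 𝓥 := by
      ext ζ'
      simp only [Finset.mem_biUnion, Finset.mem_filter, t, 𝓥, Set.mem_setOf_eq, avoidSet,
        Finset.mem_univ, true_and]
      constructor
      · rintro ⟨y, hy, h1, hsub⟩
        exact ⟨h1, y, hy, hsub⟩
      · rintro ⟨h1, y, hy, hsub⟩
        exact ⟨y, hy, h1, hsub⟩
    have e2 : s.card ≤ (Finset.univ.filter fun ζ : Config E =>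
        o ∉ cluster ends ζ h ∧ cluster ends ζ h ∈ 𝓥).card := by
      refine Finset.card_le_card_of_injOn (fun y => y.1) ?_ ?_
      · intro y hy
        rw [Finset.mem_coe] at hy
        have hy1 := y.2
        simp only [avoidSet, Finset.mem_filter, Finset.mem_univ, true_and] at hy1
        simp only [Finset.mem_coe, Finset.mem_filter, Finset.mem_univ, true_and]
        exact ⟨hy1, y, hy, subset_rfl⟩
      · intro x _ y _ hxy
        exact Subtype.ext hxy
    rw [e1]
    refine Nat.le_trans e2 ?_
    convert card_avoid_le ends o h h𝓥 using 4
  obtain ⟨f, hf, hft⟩ := (Finset.all_card_le_biUnion_card_iff_exists_injective t).1 hall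
  refine ⟨f, hf, fun y => ?_⟩
  have := hft y
  simp only [t, Finset.mem_filter] at this
  exact this

end HarrisHall

section CutO

variable {E₁ E₂ : Type*} {ends₁ : E₁ → Sym2 V} {ends₂ : E₂ → Sym2 V} {c : V} {V₁ V₂ : Set V}

/-- The cut vertex is in the cluster of `v ∈ V₁` iff it is in its `G₁`-cluster. -/
lemma mem_cluster_glue_c_iff (hg : IsGluing ends₁ ends₂ c V₁ V₂) {ζ : Config (E₁ ⊕ E₂)} {v : V}
    (hv : v ∈ V₁) : c ∈ cluster (glue ends₁ ends₂) ζ v ↔ c ∈ cluster ends₁ (ζ ∘ Sum.inl) v := by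
  rw [cluster_glue_eq hg hv]
  simp only [Set.mem_union, Set.mem_setOf_eq]
  constructor
  · rintro (h | ⟨h, _⟩) <;> exact h
  · exact Or.inl

variable [Fintype E₁] [Fintype E₂] [DecidableEq E₁] [DecidableEq E₂]

/-- **(SW) across a cut at `o`** (`c = o`, `l` on the first side, `h` on the second): `(id, θ)` with
the avoidance permutation `θ` of the `h`-side — no hypothesis on the sides. -/
theorem sw_glue_cut_o {l h o : V} (hg : IsGluing ends₁ ends₂ o V₁ V₂) (hl : l ∈ V₁) (hh : h ∈ V₂)
    (hho : h ≠ o) : Sw (glue ends₁ ends₂) l h o := by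
  obtain ⟨θ, hθ, hmemθ⟩ := exists_avoidPerm ends₂ o h
  have key : ∀ ζ : Config (E₁ ⊕ E₂),
      ζ ∈ tgtU (glue ends₁ ends₂) l h {S : Set V | o ∈ S} ↔
        (o ∈ cluster ends₁ (ζ ∘ Sum.inl) l ∧ o ∉ cluster ends₁ (blue (ζ ∘ Sum.inl)) l) ∧
          o ∉ cluster ends₂ (ζ ∘ Sum.inr) h := by
    intro ζ
    rw [mem_tgtU_glue_iff, mem_cluster_glue_c_iff hg hl, mem_cluster_glue_c_iff hg hl,
      mem_cluster_glue_iff_across hg hl hh hho, mem_cluster_glue_iff_across hg hl hh hho,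
      blue_comp_inl, blue_comp_inr]
    constructor
    · rintro ⟨⟨h1, _⟩, h3, h4⟩
      refine ⟨⟨h3, h4⟩, fun h5 => h1 ⟨h3, ?_⟩⟩
      exact mem_cluster_comm.1 h5
    · rintro ⟨⟨h3, h4⟩, h5⟩
      refine ⟨⟨fun h1 => h5 (mem_cluster_comm.1 h1.2), fun h2 => h4 h2.1⟩, h3, h4⟩
  refine ⟨fun x => pair (x.1 ∘ Sum.inl) (θ ⟨x.1 ∘ Sum.inr, ?_⟩), ?_, ?_⟩
  · simp only [avoidSet, Finset.mem_filter, Finset.mem_univ, true_and]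
    exact ((key _).1 x.2).2
  · intro x y hxy
    have h1 := congrArg (fun ζ => ζ ∘ Sum.inl) hxy
    have h2 := congrArg (fun ζ => ζ ∘ Sum.inr) hxy
    simp only [pair_inl, pair_inr] at h1 h2
    have h2' : x.1 ∘ Sum.inr = y.1 ∘ Sum.inr := congrArg Subtype.val (hθ h2)
    apply Subtype.ext
    rw [← pair_comp x.1, ← pair_comp y.1, h1, h2']
  · intro x
    have hx := (key x.1).1 x.2
    obtain ⟨hθmem, hsub⟩ := hmemθ ⟨x.1 ∘ Sum.inr, by
      simp only [avoidSet, Finset.mem_filter, Finset.mem_univ, true_and]; exact hx.2⟩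
    refine ⟨(key _).2 ⟨by rw [pair_inl]; exact hx.1, ?_⟩, ?_⟩
    · rw [pair_inr]
      simpa only [avoidSet, Finset.mem_filter, Finset.mem_univ, true_and] using hθmem
    · intro u hu
      rw [cluster_glue_eq₂ hg hh] at hu
      rw [cluster_glue_eq₂ hg hh, blue_pair, pair_inr]
      rcases hu with hu | ⟨ho, _⟩
      · exact Or.inl (hsub hu)
      · exact absurd ho hx.2

end CutO

end Glue

end Summit.Ventures.PercRepro2
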